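import Literature.AlgebraicTopology.CharacteristicClasses.LineThomClassLowDegree
import Literature.AlgebraicTopology.SingularHomology.RelativeCochainsExcision
import Literature.AlgebraicTopology.SingularHomology.RelativeCochainsMaps
import Literature.AlgebraicTopology.SingularHomology.TwoPieceProductCohomology
import HarnessLib

/-!
# Uniqueness of normalised classes over a union of two open sets (the pair-sequence step)

J. Milnor, J. Stasheff, *Characteristic Classes* (1974), §10, proof of Thm. 10.4 (uniqueness of the
Thom class for bundles of finite type, by induction on the number of open sets of a trivialising
cover, "using the Mayer–Vietoris sequence"), here organised through the long exact sequence of the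
PAIR `(D_S, D_{S₁})`, excision to `(D_{S₂}, D_{S₁ ∩ S₂})` and the naturality of the coboundary under
the projection `π` and the section at infinity `s_∞` (Hatcher 2002, §3.1 pp. 199–201;
`RelativeCochains*` of the tree) — which, unlike Mayer–Vietoris, is available for MAPS of pairs.

**Template** (`eq_zero_of_pair_template`): on `D_S = P(λ ⊕ ℂ)|_S`, `S = S₁ ∪ S₂` open, a class
`y ∈ Hⁱ⁺¹` vanishing on `D_{S₁}` and on `D_{S₂}`, with `s_∞^* y = 0`, vanishes as soon as every class of
`Hⁱ(D_{S₁ ∩ S₂})` is pulled back from the base: `y` comes from `Hⁱ⁺¹(D_S, D_{S₁}) ≅ Hⁱ⁺¹(D_{S₂}, D_{S₁∩S₂})`,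
there it is a coboundary `δ z`, `z = π^* w`, so `δ z = π^* δ w` and `y = π^* u`; then
`u = s_∞^* y = 0`.

Consequences: **`isInfDetected_union`** (degree `1`) and **`isFibreDetected_union`** (degree `2`):
the detection properties of `LineThomClassLowDegree` pass from `S₁`, `S₂` to `S₁ ∪ S₂` when
`S₁ ∩ S₂` has pulled-back classes in the degree below. Everything is proved; no named facts.

## References

* J. Milnor, J. Stasheff, *Characteristic Classes*, PUP 1974, §10 pp. 111–113. [MilnorStasheff1974]
* A. Hatcher, *Algebraic Topology*, CUP 2002, §3.1 pp. 199–201 (pairs, excision, naturality). [HatcherAT2002]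
-/

noncomputable section

open CategoryTheory Function Set Bundle Literature.AlgebraicTopology.SingularHomology
open scoped LinearAlgebra.Projectivization

universe u

namespace Literature.AlgebraicTopology.CharacteristicClasses

variable {B : Type u} [TopologicalSpace B] (F : Type u) [NormedAddCommGroup F] [NormedSpace ℂ F] [FiniteDimensional ℂ F]
  (E : B → Type u) [∀ b, AddCommGroup (E b)] [∀ b, Module ℂ (E b)]
  [TopologicalSpace (TotalSpace F E)] [∀ b, TopologicalSpace (E b)] [FiberBundle F E] [VectorBundle ℂ F E]
  (hF : Module.finrank ℂ F = 1) (R : Type u) [CommRing R]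

/-! ### The maps of pairs `π`, `s_∞` between `(D_S, D_{S₁})`, `(D_{S₂}, D_{S₁ ∩ S₂})` and their base analogues -/

section Maps

variable {F E} (T S₁ S₂ : Set B)

/-- `π` maps the piece over `S₁` into the base piece over `S₁`. [folklore] -/
theorem mapsTo_complProjOn_piece : MapsTo (complProjOn F E T) (complPiece F E T S₁) (basePiece T S₁) := fun _ h ↦ h

/-- `s_∞` maps the base piece over `S₁` into the piece over `S₁`. [folklore] -/
theorem mapsTo_complInfOn_piece : MapsTo (complInfOn F E hF T) (basePiece T S₁) (complPiece F E T S₁) := fun _ h ↦ h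

/-- `π` restricted to the pieces over `S₂`. [folklore] -/
abbrev projPiece : C(↥(complPiece F E T S₂), ↥(basePiece T S₂)) :=
  relSingularCohomology.restrictPair (complProjOn F E T) (mapsTo_complProjOn_piece T S₂)

/-- `s_∞` restricted to the pieces over `S₂`. [folklore] -/
abbrev infPiece : C(↥(basePiece T S₂), ↥(complPiece F E T S₂)) :=
  relSingularCohomology.restrictPair (complInfOn F E hF T) (mapsTo_complInfOn_piece hF T S₂)

/-- `π|` maps `D_{S₂} ∩ D_{S₁}` into the corresponding base set. [folklore] -/
theorem mapsTo_projPiece :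
    MapsTo (projPiece T S₂ : ↥(complPiece F E T S₂) → ↥(basePiece T S₂))
      (Subtype.val ⁻¹' complPiece F E T S₁) (Subtype.val ⁻¹' basePiece T S₁) := fun _ h ↦ h

/-- `s_∞|` maps the base overlap into `D_{S₂} ∩ D_{S₁}`. [folklore] -/
theorem mapsTo_infPiece :
    MapsTo (infPiece hF T S₂ : ↥(basePiece T S₂) → ↥(complPiece F E T S₂))
      (Subtype.val ⁻¹' basePiece T S₁) (Subtype.val ⁻¹' complPiece F E T S₁) := fun _ h ↦ h

/-- `D_{S₁ ∩ S₂} ≃ₜ (D_{S₂} ∩ D_{S₁}` as a subspace of `D_{S₂} ⊆ D_S`). [folklore] -/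
def overlapHomeomorph (h₁ : S₁ ∩ S₂ ⊆ T) :
    ↥(complPreimage F E (S₁ ∩ S₂)) ≃ₜ ↥(Subtype.val ⁻¹' complPiece F E T S₁ : Set ↥(complPiece F E T S₂)) where
  toFun p := ⟨⟨⟨p.1, h₁ p.2⟩, p.2.2⟩, p.2.1⟩
  invFun q := ⟨q.1.1.1, ⟨q.2, q.1.2⟩⟩
  left_inv _ := rfl
  right_inv _ := rfl
  continuous_toFun := ((continuous_subtype_val.subtype_mk _).subtype_mk _).subtype_mk _
  continuous_invFun := ((continuous_subtype_val.comp continuous_subtype_val).comp continuous_subtype_val).subtype_mk _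

/-- `S₁ ∩ S₂ ≃ₜ` the corresponding double subspace of the base. [folklore] -/
def baseOverlapHomeomorph (h₁ : S₁ ∩ S₂ ⊆ T) :
    ↥(S₁ ∩ S₂) ≃ₜ ↥(Subtype.val ⁻¹' basePiece T S₁ : Set ↥(basePiece T S₂)) where
  toFun b := ⟨⟨⟨b.1, h₁ b.2⟩, b.2.2⟩, b.2.1⟩
  invFun c := ⟨c.1.1.1, ⟨c.2, c.1.2⟩⟩
  left_inv _ := rfl
  right_inv _ := rfl
  continuous_toFun := ((continuous_subtype_val.subtype_mk _).subtype_mk _).subtype_mk _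
  continuous_invFun := ((continuous_subtype_val.comp continuous_subtype_val).comp continuous_subtype_val).subtype_mk _

/-- `π` between the overlaps `D_{S₂} ∩ D_{S₁} → ↥S₂ ∩ ↥S₁`. [folklore] -/
abbrev projOverlap :
    C(↥(Subtype.val ⁻¹' complPiece F E T S₁ : Set ↥(complPiece F E T S₂)),
      ↥(Subtype.val ⁻¹' basePiece T S₁ : Set ↥(basePiece T S₂))) :=
  relSingularCohomology.restrictPair (projPiece (F := F) (E := E) T S₂) (mapsTo_projPiece (F := F) (E := E) T S₁ S₂)

/-- `s_∞` between the overlaps. [folklore] -/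
abbrev infOverlap :
    C(↥(Subtype.val ⁻¹' basePiece T S₁ : Set ↥(basePiece T S₂)),
      ↥(Subtype.val ⁻¹' complPiece F E T S₁ : Set ↥(complPiece F E T S₂))) :=
  relSingularCohomology.restrictPair (infPiece (F := F) (E := E) hF T S₂) (mapsTo_infPiece (F := F) (E := E) hF T S₁ S₂)

/-- `π` on the overlaps corresponds to `π` on `D_{S₁ ∩ S₂}`. [folklore] -/
theorem projOverlap_comp_overlapHomeomorph (h₁ : S₁ ∩ S₂ ⊆ T) :
    (projOverlap (F := F) (E := E) T S₁ S₂).comp (overlapHomeomorph (F := F) (E := E) T S₁ S₂ h₁ : C(_, _)) =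
      (baseOverlapHomeomorph T S₁ S₂ h₁ : C(_, _)).comp (complProjOn F E (S₁ ∩ S₂)) := rfl

/-- `s_∞` on the overlaps corresponds to `s_∞` on `S₁ ∩ S₂`. [folklore] -/
theorem infOverlap_comp_baseOverlapHomeomorph (h₁ : S₁ ∩ S₂ ⊆ T) :
    (infOverlap (F := F) (E := E) hF T S₁ S₂).comp (baseOverlapHomeomorph T S₁ S₂ h₁ : C(_, _)) =
      (overlapHomeomorph (F := F) (E := E) T S₁ S₂ h₁ : C(_, _)).comp (complInfOn F E hF (S₁ ∩ S₂)) := rfl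

/-- **Transport of `IsPulledBack (S₁ ∩ S₂)` to the overlap subspaces.** [folklore] -/
theorem eq_map_projOverlap (h₁ : S₁ ∩ S₂ ⊆ T) {i : ℕ} (hpb : IsPulledBack F E hF R (S₁ ∩ S₂) i)
    (z : singularCohomology R R ↥(Subtype.val ⁻¹' complPiece F E T S₁ : Set ↥(complPiece F E T S₂)) i) :
    z = singularCohomology.map R R (projOverlap (F := F) (E := E) T S₁ S₂) i
      (singularCohomology.map R R (infOverlap (F := F) (E := E) hF T S₁ S₂) i z) := by
  have hinj : Function.Injective
      (singularCohomology.map R R (overlapHomeomorph (F := F) (E := E) T S₁ S₂ h₁ :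
        C(↥(complPreimage F E (S₁ ∩ S₂)), ↥(Subtype.val ⁻¹' complPiece F E T S₁ : Set ↥(complPiece F E T S₂)))) i) := by
    refine Function.LeftInverse.injective
      (g := singularCohomology.map R R ((overlapHomeomorph (F := F) (E := E) T S₁ S₂ h₁).symm :
        C(↥(Subtype.val ⁻¹' complPiece F E T S₁ : Set ↥(complPiece F E T S₂)), ↥(complPreimage F E (S₁ ∩ S₂)))) i)
      fun x ↦ ?_
    rw [← ModuleCat.comp_apply, ← singularCohomology.map_comp, Homeomorph.toContinuousMap_comp_symm,
      singularCohomology.map_id]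
    rfl
  apply hinj
  have e1 := congrArg (fun f ↦ singularCohomology.map R R f i z) (infOverlap_comp_baseOverlapHomeomorph hF T S₁ S₂ h₁)
  have e2 := congrArg (fun f ↦ singularCohomology.map R R f i
    (singularCohomology.map R R (infOverlap (F := F) (E := E) hF T S₁ S₂) i z))
    (projOverlap_comp_overlapHomeomorph (F := F) (E := E) T S₁ S₂ h₁)
  simp only [singularCohomology.map_comp, ModuleCat.comp_apply] at e1 e2
  have h1 := hpb (singularCohomology.map R R (overlapHomeomorph (F := F) (E := E) T S₁ S₂ h₁ :
    C(↥(complPreimage F E (S₁ ∩ S₂)), ↥(Subtype.val ⁻¹' complPiece F E T S₁ : Set ↥(complPiece F E T S₂)))) i z)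
  rw [← e1, ← e2] at h1
  exact h1

end Maps

/-! ### The template -/

variable {F E}

/-- **The pair-sequence template** (Milnor–Stasheff §10, uniqueness step): on `D_S`, `S = S₁ ∪ S₂`
open, a class of degree `i + 1` vanishing on `D_{S₁}` and on `D_{S₂}` and killed by `s_∞^*` vanishes,
provided every class of `Hⁱ(D_{S₁ ∩ S₂})` is pulled back from `S₁ ∩ S₂`.
[cite: MilnorStasheff1974, §10 pp. 111–113] -/
theorem eq_zero_of_pair_template {S₁ S₂ : Set B} (hS₁ : IsOpen S₁) (hS₂ : IsOpen S₂) {i : ℕ}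
    (hpb : IsPulledBack F E hF R (S₁ ∩ S₂) i)
    (y : singularCohomology R R ↥(complPreimage F E (S₁ ∪ S₂)) (i + 1))
    (hy₁ : singularCohomology.map R R (complPreimageIncl (subset_union_left : S₁ ⊆ S₁ ∪ S₂)) (i + 1) y = 0)
    (hy₂ : singularCohomology.map R R (complPreimageIncl (subset_union_right : S₂ ⊆ S₁ ∪ S₂)) (i + 1) y = 0)
    (hinf : singularCohomology.map R R (complInfOn F E hF (S₁ ∪ S₂)) (i + 1) y = 0) : y = 0 := by
  -- notation: pieces of the total space and of the base
  set A : Set ↥(complPreimage F E (S₁ ∪ S₂)) := complPiece F E (S₁ ∪ S₂) S₁ with hA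
  set A₂ : Set ↥(complPreimage F E (S₁ ∪ S₂)) := complPiece F E (S₁ ∪ S₂) S₂ with hA₂
  set AB : Set ↥(S₁ ∪ S₂) := basePiece (S₁ ∪ S₂) S₁ with hAB
  set AB₂ : Set ↥(S₁ ∪ S₂) := basePiece (S₁ ∪ S₂) S₂ with hAB₂
  have hπc : Continuous fun p : ↥(complPreimage F E (S₁ ∪ S₂)) ↦ p.1.proj := (complProj F E).continuous.comp continuous_subtype_val
  have hAo : IsOpen A := hS₁.preimage hπc
  have hA₂o : IsOpen A₂ := hS₂.preimage hπc
  have hABo : IsOpen AB := hS₁.preimage continuous_subtype_val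
  have hAB₂o : IsOpen AB₂ := hS₂.preimage continuous_subtype_val
  have hcov : interior A ∪ interior A₂ = univ := by
    rw [hAo.interior_eq, hA₂o.interior_eq]; exact eq_univ_of_forall fun p ↦ p.2
  have hcovB : interior AB ∪ interior AB₂ = univ := by
    rw [hABo.interior_eq, hAB₂o.interior_eq]; exact eq_univ_of_forall fun p ↦ p.2
  -- (1) `y` restricts to zero on `↥A`, hence comes from `H(X, A)`
  have hyA : singularCohomology.map R R (subsetIncl A) (i + 1) y = 0 := by
    have e : subsetIncl A = (complPreimageIncl (subset_union_left : S₁ ⊆ (S₁ ∪ S₂))).comp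
        ((complPieceHomeomorph F E (subset_union_left : S₁ ⊆ (S₁ ∪ S₂))).symm : C(↥A, ↥(complPreimage F E S₁))) := rfl
    rw [e, singularCohomology.map_comp, ModuleCat.comp_apply, hy₁, map_zero]
  obtain ⟨yr, hyr⟩ : ∃ yr : relSingularCohomology R R ↥(complPreimage F E (S₁ ∪ S₂)) A (i + 1),
      relSingularCohomology.toAbsolute R R _ A (i + 1) yr = y := by
    have ex := relSingularCohomology.exact_toAbsolute_map (R := R) (M := R) (X := ↥(complPreimage F E (S₁ ∪ S₂))) A (i + 1)
    rw [ShortComplex.moduleCat_exact_iff] at ex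
    exact ex y hyA
  -- (2) excision to the pair `(↥A₂, A₂ ∩ A)`; there the class is a coboundary
  set exc := relSingularCohomology.map R R (subsetIncl A₂) (mapsTo_preimage Subtype.val A) (i + 1) with hexc
  haveI : IsIso exc := relSingularCohomology.isIso_map_subsetIncl_of_interior R R A A₂ hcov (i + 1)
  have htoAbs : relSingularCohomology.toAbsolute R R ↥A₂ (Subtype.val ⁻¹' A) (i + 1) (exc yr) = 0 := by
    rw [hexc, ← ModuleCat.comp_apply, relSingularCohomology.map_comp_toAbsolute, ModuleCat.comp_apply, hyr]
    have e : subsetIncl A₂ = (complPreimageIncl (subset_union_right : S₂ ⊆ (S₁ ∪ S₂))).comp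
        ((complPieceHomeomorph F E (subset_union_right : S₂ ⊆ (S₁ ∪ S₂))).symm : C(↥A₂, ↥(complPreimage F E S₂))) := rfl
    rw [e, singularCohomology.map_comp, ModuleCat.comp_apply, hy₂, map_zero]
  obtain ⟨z, hz⟩ : ∃ z : singularCohomology R R ↥(Subtype.val ⁻¹' A : Set ↥A₂) i,
      relSingularCohomology.δ R R ↥A₂ (Subtype.val ⁻¹' A) i (i + 1) rfl z = exc yr := by
    have ex := relSingularCohomology.exact_δ_toAbsolute (R := R) (M := R) (X := ↥A₂) (Subtype.val ⁻¹' A) i (i + 1) rfl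
    rw [ShortComplex.moduleCat_exact_iff] at ex
    exact ex _ htoAbs
  -- (3) `z` is pulled back from the base overlap (transport of `hpb`)
  set w := singularCohomology.map R R (infOverlap (F := F) (E := E) hF (S₁ ∪ S₂) S₁ S₂) i z with hw
  have hzw : z = singularCohomology.map R R (projOverlap (F := F) (E := E) (S₁ ∪ S₂) S₁ S₂) i w :=
    eq_map_projOverlap hF R (S₁ ∪ S₂) S₁ S₂ (inter_subset_left.trans subset_union_left) hpb z
  -- (4) naturality of `δ` under the projection of pairs: `δ (π^* w) = π^* (δ w)`
  have hδ : relSingularCohomology.δ R R ↥A₂ (Subtype.val ⁻¹' A) i (i + 1) rfl z =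
      relSingularCohomology.map R R (projPiece (F := F) (E := E) (S₁ ∪ S₂) S₂) (mapsTo_projPiece (F := F) (E := E) (S₁ ∪ S₂) S₁ S₂) (i + 1)
        (relSingularCohomology.δ R R ↥AB₂ (Subtype.val ⁻¹' AB) i (i + 1) rfl w) := by
    rw [hzw, ← ModuleCat.comp_apply, ← relSingularCohomology.δ_comp_map (projPiece (F := F) (E := E) (S₁ ∪ S₂) S₂)
      (mapsTo_projPiece (F := F) (E := E) (S₁ ∪ S₂) S₁ S₂) i (i + 1) rfl, ModuleCat.comp_apply]
  -- (5) base excision and the class `ur` on the base pair `(↥(S₁ ∪ S₂), AB)`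
  set excB := relSingularCohomology.map R R (subsetIncl AB₂) (mapsTo_preimage Subtype.val AB) (i + 1) with hexcB
  haveI : IsIso excB := relSingularCohomology.isIso_map_subsetIncl_of_interior R R AB AB₂ hcovB (i + 1)
  set ur := inv excB (relSingularCohomology.δ R R ↥AB₂ (Subtype.val ⁻¹' AB) i (i + 1) rfl w) with hur
  have hexcBur : excB ur = relSingularCohomology.δ R R ↥AB₂ (Subtype.val ⁻¹' AB) i (i + 1) rfl w := by
    rw [hur, ← ModuleCat.comp_apply, IsIso.inv_hom_id, ModuleCat.id_apply]
  -- the projection of pairs `(X, A) → (↥(S₁ ∪ S₂), AB)` and the naturality of excision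
  set pipair := relSingularCohomology.map R R (complProjOn F E (S₁ ∪ S₂)) (mapsTo_complProjOn_piece (F := F) (E := E) (S₁ ∪ S₂) S₁) (i + 1) with hpipair
  have hnat : pipair ≫ exc = excB ≫ relSingularCohomology.map R R (projPiece (F := F) (E := E) (S₁ ∪ S₂) S₂) (mapsTo_projPiece (F := F) (E := E) (S₁ ∪ S₂) S₁ S₂) (i + 1) := by
    rw [hpipair, hexc, hexcB, ← relSingularCohomology.map_comp, ← relSingularCohomology.map_comp]
    rfl
  have hyr' : yr = pipair ur := by
    have hinj : Function.Injective exc := fun a b hab ↦ by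
      have := congrArg (inv exc) hab
      rwa [← ModuleCat.comp_apply, ← ModuleCat.comp_apply, IsIso.hom_inv_id, ModuleCat.id_apply, ModuleCat.id_apply] at this
    apply hinj
    rw [← ModuleCat.comp_apply pipair, hnat, ModuleCat.comp_apply, hexcBur, ← hδ, hz]
  -- (6) `y = π^* u`, and `u = s_∞^* y = 0`
  set u := relSingularCohomology.toAbsolute R R ↥(S₁ ∪ S₂) AB (i + 1) ur with hu
  have hyu : y = singularCohomology.map R R (complProjOn F E (S₁ ∪ S₂)) (i + 1) u := by
    rw [← hyr, hyr', hu, hpipair, ← ModuleCat.comp_apply, relSingularCohomology.map_comp_toAbsolute, ModuleCat.comp_apply]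
  have hu0 : u = 0 := by
    have := hinf
    rw [hyu, ← ModuleCat.comp_apply, ← singularCohomology.map_comp, complProjOn_comp_complInfOn,
      singularCohomology.map_id] at this
    exact this
  rw [hyu, hu0, map_zero]

/-! ### Consequences: the detection properties pass to unions -/

/-- **Degree one**: if degree-one classes killed by `s_∞^*` vanish over `S₁` and over `S₂`, and
degree-zero classes over `S₁ ∩ S₂` are pulled back, then degree-one classes killed by `s_∞^*` vanish
over `S₁ ∪ S₂`. [cite: MilnorStasheff1974, §10 pp. 111–113] -/
theorem isInfDetected_union {S₁ S₂ : Set B} (hS₁ : IsOpen S₁) (hS₂ : IsOpen S₂)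
    (h₁ : IsInfDetected F E hF R S₁ 1) (h₂ : IsInfDetected F E hF R S₂ 1) (hpb : IsPulledBack F E hF R (S₁ ∩ S₂) 0) :
    IsInfDetected F E hF R (S₁ ∪ S₂) 1 := by
  intro y hy
  refine eq_zero_of_pair_template hF R hS₁ hS₂ hpb y (h₁ _ ?_) (h₂ _ ?_) hy
  · rw [← ModuleCat.comp_apply, ← singularCohomology.map_comp, complPreimageIncl_comp_complInfOn hF,
      singularCohomology.map_comp, ModuleCat.comp_apply, hy, map_zero]
  · rw [← ModuleCat.comp_apply, ← singularCohomology.map_comp, complPreimageIncl_comp_complInfOn hF,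
      singularCohomology.map_comp, ModuleCat.comp_apply, hy, map_zero]

/-- **Degree two (uniqueness step)**: if fibre detection holds over `S₁` and over `S₂`, and
degree-one classes over `S₁ ∩ S₂` are pulled back, then fibre detection holds over `S₁ ∪ S₂`.
[cite: MilnorStasheff1974, §10 Thm. 10.4] -/
theorem isFibreDetected_union {S₁ S₂ : Set B} (hS₁ : IsOpen S₁) (hS₂ : IsOpen S₂)
    (h₁ : IsFibreDetected F E hF R S₁) (h₂ : IsFibreDetected F E hF R S₂) (hpb : IsPulledBack F E hF R (S₁ ∩ S₂) 1) :
    IsFibreDetected F E hF R (S₁ ∪ S₂) := by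
  intro x hinf hfib
  refine eq_zero_of_pair_template hF R hS₁ hS₂ hpb x (h₁ _ ?_ fun b hb ↦ ?_) (h₂ _ ?_ fun b hb ↦ ?_) hinf
  · rw [← ModuleCat.comp_apply, ← singularCohomology.map_comp, complPreimageIncl_comp_complInfOn hF,
      singularCohomology.map_comp, ModuleCat.comp_apply, hinf, map_zero]
  · rw [← ModuleCat.comp_apply, ← singularCohomology.map_comp, complPreimageIncl_comp_complFibOn,
      hfib b (Or.inl hb)]
  · rw [← ModuleCat.comp_apply, ← singularCohomology.map_comp, complPreimageIncl_comp_complInfOn hF,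
      singularCohomology.map_comp, ModuleCat.comp_apply, hinf, map_zero]
  · rw [← ModuleCat.comp_apply, ← singularCohomology.map_comp, complPreimageIncl_comp_complFibOn,
      hfib b (Or.inr hb)]

end Literature.AlgebraicTopology.CharacteristicClasses
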